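import Mathlib.Analysis.Normed.Module.Basic
import Mathlib.Topology.Algebra.Order.Floor
import Mathlib.Topology.Instances.Int
import Mathlib.Analysis.Normed.Group.Constructions
import HarnessLib

/-!
# Cubical sets in `ℝᴺ`: grid faces, skeleta and affine face charts

Topic `Literature/AlgebraicTopology/Homotopy`. Combinatorics of the unit grid of
`ℝᴺ = Fin N → ℝ` (sup norm), used by `CubicalExtension.lean` to prove the extension lemma
"a map from a finite union of grid cubes to a space with vanishing homotopy groups is
null-homotopic" (Hatcher, *Algebraic Topology* (2002), Lemma 4.7 / proof of Prop. 0.16, for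
cubical instead of CW complexes) and, from it, the contractibility of weakly contractible
compact neighbourhood retracts (`NeighbourhoodRetractContractible.lean`).

* `Cubical.closedFace S m`, `Cubical.openFace S m`: the closed / open face of the unit grid with
  free coordinates `S : Finset (Fin N)` and integer corner `m : Fin N → ℤ`
  (`xᵢ ∈ [mᵢ, mᵢ + 1]` for `i ∈ S`, `xᵢ = mᵢ` otherwise); every point lies in exactly one open
  face, the one indexed by its set of non-integral coordinates `nonInt x` and its integer part
  `⌊x⌋` (`mem_openFace_nonInt_floor`, `eq_of_mem_openFace`).
* `Cubical.carrier K`, `K : Finset (Fin N → ℤ)`: the cubical set `⋃_{m ∈ K} [m, m + 1]`, and its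
  skeleta `Cubical.skel K k` (points with at most `k` non-integral coordinates), closed, with
  `skel K N = carrier K`; the closed face through a point of `carrier K` lies in `carrier K`
  (`closedFace_nonInt_floor_subset`).
* `Cubical.faceMap`, `Cubical.faceInv`: the affine chart `[-1, 1]ᵏ → closedFace S m` of a
  `k`-face (`k = |S|`) and its inverse, matching closed ball / sphere / open ball of the sup norm
  with closed face / its boundary / open face.

Everything is elementary and proved; no named facts. [folklore] throughout.

## References

* A. Hatcher, *Algebraic Topology*, CUP (2002), Prop. 0.16, Lemma 4.7 (cell-by-cell
  extension), Appendix (CW complexes; cubes as cells). [HatcherAT2002]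
-/

noncomputable section

open Set Metric

namespace Literature.AlgebraicTopology.Homotopy

namespace Cubical

variable {N : ℕ}

/-! ### Integral coordinates -/

/-- A real number is integral if it is the cast of an integer. [folklore] -/
def IsInt (a : ℝ) : Prop := a ∈ range (Int.cast : ℤ → ℝ)

/-- Casts of integers are integral. [folklore] -/
theorem isInt_intCast (z : ℤ) : IsInt (z : ℝ) := ⟨z, rfl⟩

/-- A real number is integral iff it equals its integer part. [folklore] -/
theorem isInt_iff_floor_eq {a : ℝ} : IsInt a ↔ (⌊a⌋ : ℝ) = a := by
  constructor
  · rintro ⟨z, rfl⟩; rw [Int.floor_intCast]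
  · intro h; exact ⟨⌊a⌋, h⟩

/-- No integer lies strictly between consecutive integers. [folklore] -/
theorem not_isInt_of_mem_Ioo {a : ℝ} {z : ℤ} (h : a ∈ Ioo (z : ℝ) (z + 1)) : ¬ IsInt a := by
  rintro ⟨w, rfl⟩
  have h1 : z < w := by exact_mod_cast h.1
  have h2 : w < z + 1 := by exact_mod_cast h.2
  omega

/-- The integers are closed in `ℝ`, so non-integrality is an open condition. [folklore] -/
theorem isOpen_setOf_not_isInt : IsOpen {a : ℝ | ¬ IsInt a} :=
  Int.isClosedEmbedding_coe_real.isClosed_range.isOpen_compl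

/-- The set of non-integral coordinates of a point of `ℝᴺ`. [folklore] -/
def nonInt (x : Fin N → ℝ) : Finset (Fin N) := by
  classical exact Finset.univ.filter fun i => ¬ IsInt (x i)

/-- Membership in `nonInt x`: the coordinate is not integral. [folklore] -/
theorem mem_nonInt {x : Fin N → ℝ} {i : Fin N} : i ∈ nonInt x ↔ ¬ IsInt (x i) := by
  classical simp [nonInt]

/-- Near `x`, the non-integral coordinates of `x` stay non-integral. [folklore] -/
theorem eventually_nonInt_subset (x : Fin N → ℝ) : ∀ᶠ y in nhds x, nonInt x ⊆ nonInt y := by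
  have h : ∀ i ∈ nonInt x, ∀ᶠ y in nhds x, i ∈ nonInt y := fun i hi =>
    ((continuous_apply i).continuousAt.eventually
      (isOpen_setOf_not_isInt.mem_nhds (mem_nonInt.1 hi))).mono fun y hy => mem_nonInt.2 hy
  exact ((nonInt x).eventually_all.2 h).mono fun y hy i hi => hy i hi

/-- `x ↦ |nonInt x|` is lower semicontinuous: `{x | k < |nonInt x|}` is open. [folklore] -/
theorem isOpen_setOf_lt_card_nonInt (k : ℕ) : IsOpen {x : Fin N → ℝ | k < (nonInt x).card} := by
  rw [isOpen_iff_mem_nhds]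
  intro x hx
  exact (eventually_nonInt_subset x).mono fun y hy => lt_of_lt_of_le hx (Finset.card_le_card hy)

/-! ### Faces of the unit grid -/

/-- The **closed face** with free coordinates `S` and corner `m`:
`{x | xᵢ ∈ [mᵢ, mᵢ + 1] (i ∈ S), xᵢ = mᵢ (i ∉ S)}`. [folklore] -/
def closedFace (S : Finset (Fin N)) (m : Fin N → ℤ) : Set (Fin N → ℝ) :=
  {x | (∀ i ∈ S, (m i : ℝ) ≤ x i ∧ x i ≤ m i + 1) ∧ ∀ i ∉ S, x i = m i}

/-- The **open face** with free coordinates `S` and corner `m`: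
`{x | xᵢ ∈ (mᵢ, mᵢ + 1) (i ∈ S), xᵢ = mᵢ (i ∉ S)}`. [folklore] -/
def openFace (S : Finset (Fin N)) (m : Fin N → ℤ) : Set (Fin N → ℝ) :=
  {x | (∀ i ∈ S, (m i : ℝ) < x i ∧ x i < m i + 1) ∧ ∀ i ∉ S, x i = m i}

/-- The open face lies in the closed face. [folklore] -/
theorem openFace_subset_closedFace (S : Finset (Fin N)) (m : Fin N → ℤ) :
    openFace S m ⊆ closedFace S m :=
  fun _ hx => ⟨fun i hi => ⟨(hx.1 i hi).1.le, (hx.1 i hi).2.le⟩, hx.2⟩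

/-- Closed faces are closed. [folklore] -/
theorem isClosed_closedFace (S : Finset (Fin N)) (m : Fin N → ℤ) : IsClosed (closedFace S m) := by
  have h1 : closedFace S m = (⋂ i ∈ S, {x : Fin N → ℝ | (m i : ℝ) ≤ x i ∧ x i ≤ m i + 1}) ∩
      ⋂ i ∈ Sᶜ, {x : Fin N → ℝ | x i = m i} := by
    ext x; simp [closedFace]
  rw [h1]
  refine (isClosed_biInter fun i _ => ?_).inter (isClosed_biInter fun i _ => ?_)
  · exact (isClosed_le continuous_const (continuous_apply i)).inter
      (isClosed_le (continuous_apply i) continuous_const)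
  · exact isClosed_eq (continuous_apply i) continuous_const

/-- On an open face the non-integral coordinates are exactly the free ones. [folklore] -/
theorem nonInt_eq_of_mem_openFace {S : Finset (Fin N)} {m : Fin N → ℤ} {x : Fin N → ℝ}
    (hx : x ∈ openFace S m) : nonInt x = S := by
  ext i
  rw [mem_nonInt]
  by_cases hi : i ∈ S
  · simp only [hi, iff_true]
    exact not_isInt_of_mem_Ioo (hx.1 i hi)
  · simp only [hi, iff_false, not_not, hx.2 i hi]
    exact isInt_intCast _

/-- On an open face the corner is the integer part. [folklore] -/
theorem floor_eq_of_mem_openFace {S : Finset (Fin N)} {m : Fin N → ℤ} {x : Fin N → ℝ}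
    (hx : x ∈ openFace S m) (i : Fin N) : ⌊x i⌋ = m i := by
  by_cases hi : i ∈ S
  · exact Int.floor_eq_iff.2 ⟨(hx.1 i hi).1.le, (hx.1 i hi).2⟩
  · rw [hx.2 i hi, Int.floor_intCast]

/-- **Every point lies in the open face indexed by its non-integral coordinates and its integer
part.** [folklore] -/
theorem mem_openFace_nonInt_floor (x : Fin N → ℝ) : x ∈ openFace (nonInt x) (fun i => ⌊x i⌋) := by
  refine ⟨fun i hi => ⟨lt_of_le_of_ne (Int.floor_le _) fun h => ?_, Int.lt_floor_add_one _⟩,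
    fun i hi => ?_⟩
  · exact (mem_nonInt.1 hi) ⟨_, h⟩
  · rw [mem_nonInt, not_not, isInt_iff_floor_eq] at hi
    exact hi.symm

/-- **Open faces are disjoint or equal**: the open face through a point is unique. [folklore] -/
theorem eq_of_mem_openFace {S : Finset (Fin N)} {m : Fin N → ℤ} {x : Fin N → ℝ}
    (hx : x ∈ openFace S m) : S = nonInt x ∧ m = fun i => ⌊x i⌋ :=
  ⟨(nonInt_eq_of_mem_openFace hx).symm, funext fun i => (floor_eq_of_mem_openFace hx i).symm⟩

/-- On a closed face only free coordinates can be non-integral. [folklore] -/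
theorem nonInt_subset_of_mem_closedFace {S : Finset (Fin N)} {m : Fin N → ℤ} {x : Fin N → ℝ}
    (hx : x ∈ closedFace S m) : nonInt x ⊆ S := fun i hi => by
  by_contra his
  exact (mem_nonInt.1 hi) (hx.2 i his ▸ isInt_intCast _)

/-- A point of a closed face outside the open face has an integral free coordinate, so
strictly fewer than `|S|` non-integral coordinates. [folklore] -/
theorem card_nonInt_lt_of_mem_closedFace_diff {S : Finset (Fin N)} {m : Fin N → ℤ}
    {x : Fin N → ℝ} (hx : x ∈ closedFace S m) (hx' : x ∉ openFace S m) :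
    (nonInt x).card < S.card := by
  refine Finset.card_lt_card ⟨nonInt_subset_of_mem_closedFace hx, fun hsub => hx' ?_⟩
  refine ⟨fun i hi => ?_, hx.2⟩
  have hni : ¬ IsInt (x i) := mem_nonInt.1 (hsub hi)
  refine ⟨lt_of_le_of_ne (hx.1 i hi).1 fun h => hni (h ▸ isInt_intCast _),
    lt_of_le_of_ne (hx.1 i hi).2 fun h => hni ?_⟩
  rw [h]; exact ⟨m i + 1, by push_cast; ring⟩

/-- A point of a closed face has at most `|S|` non-integral coordinates. [folklore] -/
theorem card_nonInt_le_of_mem_closedFace {S : Finset (Fin N)} {m : Fin N → ℤ} {x : Fin N → ℝ}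
    (hx : x ∈ closedFace S m) : (nonInt x).card ≤ S.card :=
  Finset.card_le_card (nonInt_subset_of_mem_closedFace hx)

/-! ### Cubical sets and their skeleta -/

/-- The **cubical set** with cubes indexed by the finite set `K` of corners: the union of the
closed unit cubes `[m, m + 1]`, `m ∈ K`. [folklore] -/
def carrier (K : Finset (Fin N → ℤ)) : Set (Fin N → ℝ) := ⋃ m ∈ K, closedFace Finset.univ m

/-- Cubical sets are closed. [folklore] -/
theorem isClosed_carrier (K : Finset (Fin N → ℤ)) : IsClosed (carrier K) :=
  K.finite_toSet.isClosed_biUnion fun m _ => isClosed_closedFace _ m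

/-- Membership in a cubical set: the point lies in one of its closed cubes. [folklore] -/
theorem mem_carrier {K : Finset (Fin N → ℤ)} {x : Fin N → ℝ} :
    x ∈ carrier K ↔ ∃ m ∈ K, x ∈ closedFace Finset.univ m := by
  simp [carrier]

/-- **The closed face through a point of a cubical set lies in the cubical set** (it lies in any
cube containing the point). [folklore] -/
theorem closedFace_nonInt_floor_subset {K : Finset (Fin N → ℤ)} {x : Fin N → ℝ}
    (hx : x ∈ carrier K) : closedFace (nonInt x) (fun i => ⌊x i⌋) ⊆ carrier K := by
  obtain ⟨m₀, hm₀, hxm⟩ := mem_carrier.1 hx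
  intro y hy
  refine mem_carrier.2 ⟨m₀, hm₀, fun i _ => ?_, fun i hi => absurd (Finset.mem_univ i) hi⟩
  have hxi := hxm.1 i (Finset.mem_univ i)
  by_cases hi : i ∈ nonInt x
  · -- `⌊x i⌋ = m₀ i` since `x i ∈ [m₀ i, m₀ i + 1]` is not an integer
    have hni : ¬ IsInt (x i) := mem_nonInt.1 hi
    have hlt : x i < m₀ i + 1 := lt_of_le_of_ne hxi.2 fun h => hni (by
      rw [h]; exact ⟨m₀ i + 1, by push_cast; ring⟩)
    have hfl : ⌊x i⌋ = m₀ i := Int.floor_eq_iff.2 ⟨hxi.1, hlt⟩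
    have hyi := hy.1 i hi
    simp only [hfl] at hyi
    exact hyi
  · have hyi := hy.2 i hi
    have hfl : (⌊x i⌋ : ℝ) = x i := by
      rw [mem_nonInt, not_not, isInt_iff_floor_eq] at hi; exact hi
    rw [hyi, hfl]
    exact hxi

/-- The **`k`-skeleton** of a cubical set: its points with at most `k` non-integral coordinates
(the union of its closed faces of dimension `≤ k`). [folklore] -/
def skel (K : Finset (Fin N → ℤ)) (k : ℕ) : Set (Fin N → ℝ) := {x ∈ carrier K | (nonInt x).card ≤ k}

/-- Skeleta lie in the cubical set. [folklore] -/
theorem skel_subset_carrier (K : Finset (Fin N → ℤ)) (k : ℕ) : skel K k ⊆ carrier K :=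
  fun _ hx => hx.1

/-- Skeleta increase with the dimension. [folklore] -/
theorem skel_mono (K : Finset (Fin N → ℤ)) {k l : ℕ} (h : k ≤ l) : skel K k ⊆ skel K l :=
  fun _ hx => ⟨hx.1, hx.2.trans h⟩

/-- The top skeleton is everything. [folklore] -/
theorem skel_eq_carrier (K : Finset (Fin N → ℤ)) : skel K N = carrier K :=
  Subset.antisymm (skel_subset_carrier K N) fun x hx =>
    ⟨hx, (Finset.card_le_univ _).trans (by rw [Fintype.card_fin])⟩

/-- Skeleta are closed. [folklore] -/
theorem isClosed_skel (K : Finset (Fin N → ℤ)) (k : ℕ) : IsClosed (skel K k) := by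
  have h : skel K k = carrier K ∩ {x | k < (nonInt x).card}ᶜ := by
    ext x; simp [skel, not_lt]
  rw [h]
  exact (isClosed_carrier K).inter (isOpen_setOf_lt_card_nonInt k).isClosed_compl

/-- A closed face of dimension `≤ k` contained in the cubical set lies in the `k`-skeleton.
[folklore] -/
theorem closedFace_subset_skel {K : Finset (Fin N → ℤ)} {S : Finset (Fin N)} {m : Fin N → ℤ}
    {k : ℕ} (hK : closedFace S m ⊆ carrier K) (hS : S.card ≤ k) : closedFace S m ⊆ skel K k :=
  fun _ hx => ⟨hK hx, (card_nonInt_le_of_mem_closedFace hx).trans hS⟩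

/-- The boundary of a closed `(k + 1)`-face contained in the cubical set lies in the
`k`-skeleton. [folklore] -/
theorem mem_skel_of_mem_closedFace_diff {K : Finset (Fin N → ℤ)} {S : Finset (Fin N)}
    {m : Fin N → ℤ} {k : ℕ} (hK : closedFace S m ⊆ carrier K) (hS : S.card = k + 1)
    {x : Fin N → ℝ} (hx : x ∈ closedFace S m) (hx' : x ∉ openFace S m) : x ∈ skel K k :=
  ⟨hK hx, Nat.lt_succ_iff.1 (by
    have h := card_nonInt_lt_of_mem_closedFace_diff hx hx'
    rw [hS] at h
    exact h)⟩

/-- A point of the `(k + 1)`-skeleton not on any open `(k + 1)`-face of the cubical set is in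
the `k`-skeleton. [folklore] -/
theorem mem_skel_of_not_mem_openFace {K : Finset (Fin N → ℤ)} {k : ℕ} {x : Fin N → ℝ}
    (hx : x ∈ skel K (k + 1)) (h : (nonInt x).card ≠ k + 1) : x ∈ skel K k :=
  ⟨hx.1, Nat.lt_succ_iff.1 (lt_of_le_of_ne hx.2 h)⟩

/-! ### Affine charts of faces -/

section FaceMap

variable {k : ℕ} (S : Finset (Fin N)) (m : Fin N → ℤ) (e : Fin k ≃ ↥S)

/-- The **affine chart** of the face `(S, m)` by the cube `[-1, 1]ᵏ`, `k = |S|` (via an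
enumeration `e` of `S`): `w ↦ (mᵢ + (1 + w_{e⁻¹ i}) / 2)` on free coordinates, `mᵢ` elsewhere.
[folklore] -/
def faceMap (w : Fin k → ℝ) : Fin N → ℝ := fun i =>
  if h : i ∈ S then (m i : ℝ) + (1 + w (e.symm ⟨i, h⟩)) / 2 else m i

/-- The inverse chart `x ↦ (2 (x_{e j} - m_{e j}) - 1)ⱼ`. [folklore] -/
def faceInv (x : Fin N → ℝ) : Fin k → ℝ := fun j => 2 * (x (e j) - m (e j)) - 1

/-- The affine chart of a face is continuous. [folklore] -/
@[fun_prop]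
theorem continuous_faceMap : Continuous (faceMap S m e) := by
  refine continuous_pi fun i => ?_
  by_cases h : i ∈ S
  · simp only [faceMap, h, dif_pos]
    fun_prop
  · simp only [faceMap, h, dif_neg, not_false_eq_true]
    exact continuous_const

/-- The inverse chart of a face is continuous. [folklore] -/
@[fun_prop]
theorem continuous_faceInv : Continuous (faceInv S m e) :=
  continuous_pi fun j => by unfold faceInv; fun_prop

/-- The chart on a free coordinate. [folklore] -/
theorem faceMap_apply_mem {i : Fin N} (hi : i ∈ S) (w : Fin k → ℝ) :
    faceMap S m e w i = m i + (1 + w (e.symm ⟨i, hi⟩)) / 2 := by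
  simp [faceMap, hi]

/-- The chart on a frozen coordinate. [folklore] -/
theorem faceMap_apply_not_mem {i : Fin N} (hi : i ∉ S) (w : Fin k → ℝ) :
    faceMap S m e w i = m i := by
  simp [faceMap, hi]

/-- The inverse chart is a left inverse of the chart. [folklore] -/
@[simp] theorem faceInv_faceMap (w : Fin k → ℝ) : faceInv S m e (faceMap S m e w) = w := by
  ext j
  simp only [faceInv, faceMap_apply_mem S m e (e j).2, Subtype.coe_eta, Equiv.symm_apply_apply]
  ring

/-- On the closed face the chart inverts the inverse chart. [folklore] -/
theorem faceMap_faceInv {x : Fin N → ℝ} (hx : x ∈ closedFace S m) :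
    faceMap S m e (faceInv S m e x) = x := by
  ext i
  by_cases hi : i ∈ S
  · rw [faceMap_apply_mem S m e hi]
    simp only [faceInv, Equiv.apply_symm_apply]
    ring
  · rw [faceMap_apply_not_mem S m e hi, hx.2 i hi]

/-- The chart maps the closed cube `[-1, 1]ᵏ` (the closed unit ball of the sup norm) into the
closed face. [folklore] -/
theorem faceMap_mem_closedFace {w : Fin k → ℝ} (hw : w ∈ closedBall (0 : Fin k → ℝ) 1) :
    faceMap S m e w ∈ closedFace S m := by
  rw [mem_closedBall_zero_iff, pi_norm_le_iff_of_nonneg zero_le_one] at hw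
  refine ⟨fun i hi => ?_, fun i hi => faceMap_apply_not_mem S m e hi w⟩
  have h := hw (e.symm ⟨i, hi⟩)
  rw [Real.norm_eq_abs, abs_le] at h
  rw [faceMap_apply_mem S m e hi]
  constructor <;> linarith [h.1, h.2]

/-- The chart maps the open cube (open unit ball) into the open face. [folklore] -/
theorem faceMap_mem_openFace {w : Fin k → ℝ} (hw : w ∈ ball (0 : Fin k → ℝ) 1) :
    faceMap S m e w ∈ openFace S m := by
  rw [mem_ball_zero_iff, pi_norm_lt_iff one_pos] at hw
  refine ⟨fun i hi => ?_, fun i hi => faceMap_apply_not_mem S m e hi w⟩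
  have h := hw (e.symm ⟨i, hi⟩)
  rw [Real.norm_eq_abs, abs_lt] at h
  rw [faceMap_apply_mem S m e hi]
  constructor <;> linarith [h.1, h.2]

/-- The inverse chart maps the closed face into the closed cube. [folklore] -/
theorem faceInv_mem_closedBall {x : Fin N → ℝ} (hx : x ∈ closedFace S m) :
    faceInv S m e x ∈ closedBall (0 : Fin k → ℝ) 1 := by
  rw [mem_closedBall_zero_iff, pi_norm_le_iff_of_nonneg zero_le_one]
  intro j
  have h := hx.1 (e j) (e j).2
  rw [Real.norm_eq_abs, abs_le]
  simp only [faceInv]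
  constructor <;> linarith [h.1, h.2]

/-- The inverse chart maps the open face into the open cube. [folklore] -/
theorem faceInv_mem_ball {x : Fin N → ℝ} (hx : x ∈ openFace S m) :
    faceInv S m e x ∈ ball (0 : Fin k → ℝ) 1 := by
  rw [mem_ball_zero_iff, pi_norm_lt_iff one_pos]
  intro j
  have h := hx.1 (e j) (e j).2
  rw [Real.norm_eq_abs, abs_lt]
  simp only [faceInv]
  constructor <;> linarith [h.1, h.2]

/-- The inverse chart maps the boundary of the face into the boundary sphere of the cube.
[folklore] -/
theorem faceInv_mem_sphere {x : Fin N → ℝ} (hx : x ∈ closedFace S m) (hx' : x ∉ openFace S m) :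
    faceInv S m e x ∈ sphere (0 : Fin k → ℝ) 1 := by
  have h1 := faceInv_mem_closedBall S m e hx
  rw [mem_closedBall_zero_iff] at h1
  rw [mem_sphere_zero_iff_norm]
  refine le_antisymm h1 (not_lt.1 fun hlt => hx' ?_)
  have h2 := faceMap_mem_openFace S m e (mem_ball_zero_iff.2 hlt)
  rwa [faceMap_faceInv S m e hx] at h2

/-- The chart maps the boundary sphere of the cube to the boundary of the face. [folklore] -/
theorem faceMap_not_mem_openFace {w : Fin k → ℝ} (hw : w ∈ sphere (0 : Fin k → ℝ) 1) :
    faceMap S m e w ∉ openFace S m := fun h => by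
  have h1 := faceInv_mem_ball S m e h
  rw [faceInv_faceMap] at h1
  rw [mem_sphere_zero_iff_norm] at hw
  rw [mem_ball_zero_iff] at h1
  exact h1.ne hw

end FaceMap

/-- A finite set of `k` elements of `Fin N` is enumerated by `Fin k`. [folklore] -/
def enum (S : Finset (Fin N)) {k : ℕ} (hS : S.card = k) : Fin k ≃ ↥S :=
  (S.equivFin.trans (finCongr hS)).symm

end Cubical

end Literature.AlgebraicTopology.Homotopy
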